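import Summits.QuantumFields.YangMills.Theorems.UnitScaleTiltProp7CovariantModelFibre
import HarnessLib

/-!
# Route `UnitScaleTilt`, crux K1 child «MinimiserStabilityRegPr» (stmt-QuantumFields-19200), registered stub `stub_prop7From14` (leaf V3 «Prop 7 from a
# background (14)») — QUADRATIC GROWTH OF THE WILSON ACTION ALONG SECANTS ON THE (MODEL) AVERAGING FIBRE, MODULO THE FIRST-ORDER TERM:
# `(1/600)·L^{−2(K−n)}·Σ_b‖U_bU₀,b^* − 1‖² ≤ A(U) − A(U₀) − Lin_{U₀}(U)` for `U` on the model fibre of `U₀`, covariant Landau gauge, `U₀` in (14)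

Cell `ym3-torus` ∕ fleet seat `ym-ust-19200-p1` (gen 4).  WHY.  `Prop7UniquenessReduction.atMostOneCriticalOrbit_of_chart_of_quadraticGrowth` (p504929) closes
the uniqueness clause of [Balaban1985Variational] Prop. 7 at the d = 3 carrier from (chart inside the group (4)) ∧ (quadratic growth `κΣ‖Y‖² ≤ A(W) − A(U)` at a
critical `U` along its chart).  Gen 2's non-flat local-minimality model (`wilsonAction4_sub_background_ge_T3`, p482559) gives growth for TANGENT vectors (kernel of
the covariant average); its off-kernel form (`wilsonAction4_sub_background_ge_offKernel_T3`, p483802) keeps the averaging penalty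
`(1/18)(L^{kd}L^{2k})⁻¹L^{−2k}Σ_c‖A^{U₀}_cY‖²` on the left.  For a SECANT `Y = UU₀^* − 1` between two points of one fibre the penalty does not vanish but is
second order (`UnitScaleTiltProp7CovariantModelFibre`, this seat: `≤ 2·max‖Y‖²·Σ‖Y‖²` on the model fibre); this file subtracts it and records the resulting
GROWTH MODULO THE LINEAR TERM with absolute constants: coefficient `(1/600)L^{−2(K−n)}` once `ε ≤ 2.5·10⁻⁶` (plaquettes of `U₀` within `εL^{−2(K−n)}` of `1`) and
`2000·L^{K−n}·max‖Y‖ ≤ 1` (the chart scale (19); crude absolute constants inherited from the `1/288` and `128δ²` of p483802).  The remaining input of the `ℓ²` route at this point is the Euler–Lagrange control of `Lin_{U₀}(U)` at a critical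
`U₀` (multiplier form; `UnitScaleTiltProp7LineAvgAdjoint` + the lineage `Prop8Criticality`) — and the replacement of the model constraint by the (0.4) average of record.

WHAT IS PROVED HERE (sorry-free, no definition): **`wilsonAction4_sub_background_ge_of_modelFibre_T3`** (the title), a composition of p483802's off-kernel
local-minimality model with `norm_covLineSum_le_of_modelFibre` ∕ `sum_sum_normSq_line_le` ∕ `sum_pair_normSq_eq` (p520587's lemmas).

HONEST SCOPE.  Model constraint (straight contours, comb transport), FULL covariant Landau gauge `D^*_{U₀}Y = 0` (print's slice (21) is `R(U₀)D^*A = 0`; the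
`R`-engine at a small-field background is open), d = 3, `SU(2)`.  Nothing of Bałaban's is asserted.

References: T. Bałaban, CMP 102 (1985) 277–309 [Balaban1985Variational] ((19)–(21) p.281, (141)–(143) p.299).
-/

noncomputable section

open scoped BigOperators Matrix.Norms.L2Operator Matrix

namespace Summit.QuantumFields.YangMills.Theorems.Prop7CovLineAvgTaylor

open Literature.MathematicalPhysics.QuantumFieldTheory.Balaban1983to89
open Finset B1RG242Torus LatticeFieldCalculus
open B7Prop1Explicit (plaqWord U1 treeWord)
open B7Eq78Linearization (conjR)
open B9Eq39Adjoint (curl divB)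
open B10StarCount (sum_pbond)
open B10Eq27TorusAxialLog (holT unitsField toUField)
open B9TorusCalculus (torusT)
open Summit.QuantumFields.YangMills.Theorems.Prop7CovariantCoercivity (holT_mem hyp_of_specialUnitary wilsonAction4_sub_background_ge_offKernel_T3)

/-- **QUADRATIC GROWTH ALONG SECANTS ON THE MODEL FIBRE, MODULO THE LINEAR TERM, d = 3 CARRIER**: for `SU(2)` configurations `U`, `U₀` with
`dist1(U₀(∂p)) ≤ εL^{−2(K−n)}`, `4·10⁵ε ≤ 1`, `Y = UU₀^* − 1` with `‖Y‖ ≤ δ`, `2000L^{K−n}δ ≤ 1`, covariant Landau gauge `D^*_{U₀}Y = 0`, and `U` on the model averaging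
fibre of `U₀` (vanishing block sums of the comb-transported straight-contour ratios `U(line)U₀(line)⁻¹ − 1`):
`(1/600)·L^{−2(K−n)}·Σ_b‖Y(b)‖² ≤ A(U) − A(U₀) − Lin_{U₀}(U)`, `Lin_{U₀}` the exact first-order term of p482559/p483802.
[cite: Balaban1985Variational, (141)-(143) p.299] -/
theorem wilsonAction4_sub_background_ge_of_modelFibre_T3 (F : T3ContinuumYM3Torus.T3Family) (n K : ℕ)
    (U U₀ : GaugeField (F.P K) 0 (Matrix.specialUnitaryGroup (Fin 2) ℂ)) (Y : PBond (F.P K) 0 → Matrix (Fin 2) (Fin 2) ℂ)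
    (hYU : ∀ b : PBond (F.P K) 0, Y b = (U b : Matrix (Fin 2) (Fin 2) ℂ) * star (U₀ b : Matrix (Fin 2) (Fin 2) ℂ) - 1)
    {ε δ : ℝ} (hε : 0 ≤ ε) (hε1 : 400000 * ε ≤ 1)
    (hU₀ : ∀ p : Plaq (F.P K) 0, dist1 (GaugeField.plaqHol U₀ p) ≤ ε * (((F.L : ℝ) ^ (K - n)) ^ 2)⁻¹)
    (hδ : ∀ b : PBond (F.P K) 0, ‖Y b‖ ≤ δ) (hδn : 2000 * (F.L : ℝ) ^ (K - n) * δ ≤ 1)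
    (hdiv : ∀ x : Site (F.P K) 0, divB (torusT (F.P K) 0) (fun κ z => unitsField (toUField U₀) ⟨z, κ⟩) (fun κ z => Y ⟨z, κ⟩) x = 0)
    (hfib : ∀ c : PBond (F.P K) (K - n), ∑ r : Fin (F.P K).d → Fin ((F.P K).L ^ (K - n)),
      conjR (holT (unitsField (toUField U₀)) (Site.fibreSite 0 (K - n) c.src fun _ => ⟨0, pow_pos (F.P K).L_pos (K - n)⟩)
              (treeWord fun ν => ((r ν : ℕ) : ℤ)))
        (((holT (unitsField (toUField U)) (Site.fibreSite 0 (K - n) c.src r) (List.replicate ((F.P K).L ^ (K - n)) (c.dir, true))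
              : (Matrix (Fin 2) (Fin 2) ℂ)ˣ) : Matrix (Fin 2) (Fin 2) ℂ)
          * (((holT (unitsField (toUField U₀)) (Site.fibreSite 0 (K - n) c.src r) (List.replicate ((F.P K).L ^ (K - n)) (c.dir, true)))⁻¹
              : (Matrix (Fin 2) (Fin 2) ℂ)ˣ) : Matrix (Fin 2) (Fin 2) ℂ) - 1) = 0) :
    (1 / 600) * (((F.L : ℝ) ^ (K - n)) ^ 2)⁻¹ * ∑ b : PBond (F.P K) 0, ‖Y b‖ ^ 2
      ≤ wilsonAction4 U - wilsonAction4 U₀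
        - ∑ p : Plaq (F.P K) 0, (1 / 2) * ((((((GaugeField.plaqHol U₀ p : Matrix.specialUnitaryGroup (Fin 2) ℂ) : Matrix (Fin 2) (Fin 2) ℂ)) - 1)ᴴ
          * ((Y ⟨p.src, p.μ⟩
              + (U₀ ⟨p.src, p.μ⟩ : Matrix (Fin 2) (Fin 2) ℂ) * Y ⟨p.src.shift p.μ, p.ν⟩ * star (U₀ ⟨p.src, p.μ⟩ : Matrix (Fin 2) (Fin 2) ℂ)
              - ((U₀ ⟨p.src, p.μ⟩ * U₀ ⟨p.src.shift p.μ, p.ν⟩ * (U₀ ⟨p.src.shift p.ν, p.μ⟩)⁻¹ : Matrix.specialUnitaryGroup (Fin 2) ℂ) : Matrix (Fin 2) (Fin 2) ℂ)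
                  * Y ⟨p.src.shift p.ν, p.μ⟩
                  * star ((U₀ ⟨p.src, p.μ⟩ * U₀ ⟨p.src.shift p.μ, p.ν⟩ * (U₀ ⟨p.src.shift p.ν, p.μ⟩)⁻¹ : Matrix.specialUnitaryGroup (Fin 2) ℂ) : Matrix (Fin 2) (Fin 2) ℂ)
              - ((GaugeField.plaqHol U₀ p : Matrix.specialUnitaryGroup (Fin 2) ℂ) : Matrix (Fin 2) (Fin 2) ℂ) * Y ⟨p.src, p.ν⟩
                  * star ((GaugeField.plaqHol U₀ p : Matrix.specialUnitaryGroup (Fin 2) ℂ) : Matrix (Fin 2) (Fin 2) ℂ))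
            * ((GaugeField.plaqHol U₀ p : Matrix.specialUnitaryGroup (Fin 2) ℂ) : Matrix (Fin 2) (Fin 2) ℂ))).trace).re := by
  -- (0) scalar bookkeeping, done before any matrix term enters the context
  have hn0 : (0 : ℝ) < (F.L : ℝ) ^ (K - n) := by
    have : (0 : ℝ) < F.L := by have := F.hL.2; exact_mod_cast (by omega : 0 < F.L)
    positivity
  have hn1 : (1 : ℝ) ≤ (F.L : ℝ) ^ (K - n) := one_le_pow₀ (by have := F.hL.2; exact_mod_cast (by omega : 1 ≤ F.L))
  have hδ0 : 0 ≤ δ := (norm_nonneg _).trans (hδ ⟨fun _ => 0, ⟨0, (F.P K).hd⟩⟩)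
  have hδ1 : δ ≤ 1 := by nlinarith only [hδn, hn1, hδ0]
  have hε216 : 216 * ε ≤ 1 := by linarith only [hε1, hε]
  have hn2 : (0 : ℝ) < (((F.L : ℝ) ^ (K - n)) ^ 2)⁻¹ := by positivity
  have hn2le1 : (((F.L : ℝ) ^ (K - n)) ^ 2)⁻¹ ≤ 1 := inv_le_one_of_one_le₀ (one_le_pow₀ hn1)
  have hinv : ((F.L : ℝ) ^ (K - n)) ^ 2 * (((F.L : ℝ) ^ (K - n)) ^ 2)⁻¹ = 1 := mul_inv_cancel₀ (by positivity)
  have ha1 : ε * (((F.L : ℝ) ^ (K - n)) ^ 2)⁻¹ ≤ (1 / 400000) * (((F.L : ℝ) ^ (K - n)) ^ 2)⁻¹ := by nlinarith only [hε1, hn2]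
  have ha0 : 0 ≤ ε * (((F.L : ℝ) ^ (K - n)) ^ 2)⁻¹ := mul_nonneg hε hn2.le
  have ha2 : (ε * (((F.L : ℝ) ^ (K - n)) ^ 2)⁻¹) ^ 2 ≤ (1 / 400000) * (((F.L : ℝ) ^ (K - n)) ^ 2)⁻¹ := by
    have : ε * (((F.L : ℝ) ^ (K - n)) ^ 2)⁻¹ ≤ 1 := by nlinarith only [ha1, hn2le1]
    nlinarith only [this, ha0, ha1]
  have hδ2 : δ ^ 2 ≤ (1 / 4000000) * (((F.L : ℝ) ^ (K - n)) ^ 2)⁻¹ := by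
    -- `(2000 n δ)² ≤ 1`
    have h60 : 0 ≤ 2000 * (F.L : ℝ) ^ (K - n) * δ := by positivity
    have h36 : 4000000 * (((F.L : ℝ) ^ (K - n)) ^ 2 * δ ^ 2) ≤ 1 := by
      nlinarith only [hδn, h60, mul_nonneg h60 (sub_nonneg.mpr hδn)]
    nlinarith only [h36, hinv, hn2, hδ0]
  have hc : (1 / 600) * (((F.L : ℝ) ^ (K - n)) ^ 2)⁻¹
      ≤ (1 / 288) * (((F.L : ℝ) ^ (K - n)) ^ 2)⁻¹
        - 12 * (2 * (ε * (((F.L : ℝ) ^ (K - n)) ^ 2)⁻¹) ^ 2 + 128 * δ ^ 2 + 8 * (ε * (((F.L : ℝ) ^ (K - n)) ^ 2)⁻¹)) - (1 / 9) * δ ^ 2 := by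
    nlinarith only [ha1, ha2, hδ2, hn2]
  -- (1) the off-kernel local-minimality model, read with `Y`
  have hYU' : ∀ b : PBond (F.P K) 0, (U b : Matrix (Fin 2) (Fin 2) ℂ) * star (U₀ b : Matrix (Fin 2) (Fin 2) ℂ) - 1 = Y b := fun b => (hYU b).symm
  have hδ' : ∀ b : PBond (F.P K) 0, ‖(U b : Matrix (Fin 2) (Fin 2) ℂ) * star (U₀ b : Matrix (Fin 2) (Fin 2) ℂ) - 1‖ ≤ δ := fun b => by rw [hYU']; exact hδ b
  have hfun : (fun (κ : Fin (F.P K).d) (z : Site (F.P K) 0) => (U ⟨z, κ⟩ : Matrix (Fin 2) (Fin 2) ℂ) * star (U₀ ⟨z, κ⟩ : Matrix (Fin 2) (Fin 2) ℂ) - 1)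
      = fun κ z => Y ⟨z, κ⟩ := by funext κ z; exact hYU' _
  have hdiv' : ∀ x : Site (F.P K) 0, divB (torusT (F.P K) 0) (fun κ z => unitsField (toUField U₀) ⟨z, κ⟩)
      (fun κ z => (U ⟨z, κ⟩ : Matrix (Fin 2) (Fin 2) ℂ) * star (U₀ ⟨z, κ⟩ : Matrix (Fin 2) (Fin 2) ℂ) - 1) x = 0 := by rw [hfun]; exact hdiv
  have hE := wilsonAction4_sub_background_ge_offKernel_T3 F n K U U₀ hε hε216 hU₀ hδ' hδ1 hdiv'
  simp only [hYU'] at hE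
  -- (2) the averaging penalty on the model fibre
  obtain ⟨hV₀, -⟩ := hyp_of_specialUnitary U₀ hU₀
  have hsites := Prop7FlatCoercivity.sitesPerDir_T3 F n K
  have hLF : ((F.P K).L : ℝ) = (F.L : ℝ) := by norm_cast
  have hYrel : ∀ b : PBond (F.P K) 0, ((unitsField (toUField U) b : (Matrix (Fin 2) (Fin 2) ℂ)ˣ) : Matrix (Fin 2) (Fin 2) ℂ)
      = (1 + Y b) * ((unitsField (toUField U₀) b : (Matrix (Fin 2) (Fin 2) ℂ)ˣ) : Matrix (Fin 2) (Fin 2) ℂ) := by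
    intro b
    have hu : star (U₀ b : Matrix (Fin 2) (Fin 2) ℂ) * (U₀ b : Matrix (Fin 2) (Fin 2) ℂ) = 1 :=
      Matrix.mem_unitaryGroup_iff'.mp (Matrix.specialUnitaryGroup_le_unitaryGroup (U₀ b).2)
    show (U b : Matrix (Fin 2) (Fin 2) ℂ) = (1 + Y b) * (U₀ b : Matrix (Fin 2) (Fin 2) ℂ)
    rw [hYU, add_sub_cancel, mul_assoc, hu, mul_one]
  have hnδ : ((F.P K).L : ℝ) ^ (K - n) * δ ≤ 1 := by rw [hLF]; nlinarith only [hδn, hn0, hδ0]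
  have hS0 : 0 ≤ ∑ b : PBond (F.P K) 0, ‖Y b‖ ^ 2 := Finset.sum_nonneg fun _ _ => sq_nonneg _
  have hA : ∀ c : PBond (F.P K) (K - n),
      ‖∑ r : Fin (F.P K).d → Fin ((F.P K).L ^ (K - n)), ∑ t ∈ range ((F.P K).L ^ (K - n)),
        conjR (holT (unitsField (toUField U₀)) (Site.fibreSite 0 (K - n) c.src fun _ => ⟨0, pow_pos (F.P K).L_pos (K - n)⟩)
              (treeWord fun ν => ((r ν : ℕ) : ℤ))
            * holT (unitsField (toUField U₀)) (Site.fibreSite 0 (K - n) c.src r) (List.replicate t (c.dir, true)))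
          (Y ⟨(fun z : Site (F.P K) 0 => z.shift c.dir)^[t] (Site.fibreSite 0 (K - n) c.src r), c.dir⟩)‖ ^ 2
        ≤ ((F.L : ℝ) ^ (K - n)) ^ ((F.P K).d + 4) * δ ^ 2 * (∑ r : Fin (F.P K).d → Fin ((F.P K).L ^ (K - n)), ‖Y ⟨Site.fibreSite 0 (K - n) c.src r, c.dir⟩‖ ^ 2
            + ∑ r : Fin (F.P K).d → Fin ((F.P K).L ^ (K - n)), ‖Y ⟨Site.fibreSite 0 (K - n) (runSite c.src c.dir 1) r, c.dir⟩‖ ^ 2) := by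
    intro c
    have hrg : (∑ r : Fin (F.P K).d → Fin ((F.P K).L ^ (K - n)), ∑ t ∈ range ((F.P K).L ^ (K - n)),
        conjR (holT (unitsField (toUField U₀)) (Site.fibreSite 0 (K - n) c.src fun _ => ⟨0, pow_pos (F.P K).L_pos (K - n)⟩)
              (treeWord fun ν => ((r ν : ℕ) : ℤ))
            * holT (unitsField (toUField U₀)) (Site.fibreSite 0 (K - n) c.src r) (List.replicate t (c.dir, true)))
          (Y ⟨(fun z : Site (F.P K) 0 => z.shift c.dir)^[t] (Site.fibreSite 0 (K - n) c.src r), c.dir⟩))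
        = ∑ r : Fin (F.P K).d → Fin ((F.P K).L ^ (K - n)), ∑ t : Fin ((F.P K).L ^ (K - n)),
        conjR (holT (unitsField (toUField U₀)) (Site.fibreSite 0 (K - n) c.src fun _ => ⟨0, pow_pos (F.P K).L_pos (K - n)⟩)
              (treeWord fun ν => ((r ν : ℕ) : ℤ))
            * holT (unitsField (toUField U₀)) (Site.fibreSite 0 (K - n) c.src r) (List.replicate (t : ℕ) (c.dir, true)))
          (Y ⟨(fun z : Site (F.P K) 0 => z.shift c.dir)^[(t : ℕ)] (Site.fibreSite 0 (K - n) c.src r), c.dir⟩) :=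
      Finset.sum_congr rfl fun r _ => by simp only [Finset.sum_range]
    rw [hrg]
    have hT0 : 0 ≤ ∑ r : Fin (F.P K).d → Fin ((F.P K).L ^ (K - n)), ∑ t : Fin ((F.P K).L ^ (K - n)),
        ‖Y ⟨(fun z : Site (F.P K) 0 => z.shift c.dir)^[(t : ℕ)] (Site.fibreSite 0 (K - n) c.src r), c.dir⟩‖ ^ 2 :=
      Finset.sum_nonneg fun _ _ => Finset.sum_nonneg fun _ _ => sq_nonneg _
    have h1 := norm_covLineSum_le_of_modelFibre (P := F.P K) (k := K - n) hYrel hV₀ hδ hnδ c.dir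
      (fun r => holT (unitsField (toUField U₀)) (Site.fibreSite 0 (K - n) c.src fun _ => ⟨0, pow_pos (F.P K).L_pos (K - n)⟩) (treeWord fun ν => ((r ν : ℕ) : ℤ)))
      (fun r => holT_mem hV₀ _ _) (fun r => Site.fibreSite 0 (K - n) c.src r) (hfib c)
    rw [hLF] at h1
    have h2 := sum_sum_normSq_line_le (P := F.P K) (k := K - n) hsites Y c.src c.dir
    rw [hLF] at h2
    have h3 : ∑ r : Fin (F.P K).d → Fin ((F.P K).L ^ (K - n)), ∑ t : Fin ((F.P K).L ^ (K - n)),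
        ‖Y ⟨(fun z : Site (F.P K) 0 => z.shift c.dir)^[(t : ℕ)] (Site.fibreSite 0 (K - n) c.src r), c.dir⟩‖ ^ 2
          ≤ ((F.L : ℝ) ^ (K - n)) ^ ((F.P K).d + 1) * δ ^ 2 := by
      calc _ ≤ ∑ _r : Fin (F.P K).d → Fin ((F.P K).L ^ (K - n)), ∑ _t : Fin ((F.P K).L ^ (K - n)), δ ^ 2 :=
            Finset.sum_le_sum fun r _ => Finset.sum_le_sum fun t _ => pow_le_pow_left₀ (norm_nonneg _) (hδ _) 2
        _ = ((F.L : ℝ) ^ (K - n)) ^ ((F.P K).d + 1) * δ ^ 2 := by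
            rw [Finset.sum_const, Finset.sum_const, Finset.card_univ, Finset.card_univ, Fintype.card_fun, Fintype.card_fin, Fintype.card_fin,
              smul_smul, nsmul_eq_mul]
            push_cast; rw [hLF]; ring
    have hsq := pow_le_pow_left₀ (norm_nonneg _) h1 2
    refine hsq.trans ?_
    calc _ = ((F.L : ℝ) ^ (K - n)) ^ 2 * (∑ r : Fin (F.P K).d → Fin ((F.P K).L ^ (K - n)), ∑ t : Fin ((F.P K).L ^ (K - n)),
            ‖Y ⟨(fun z : Site (F.P K) 0 => z.shift c.dir)^[(t : ℕ)] (Site.fibreSite 0 (K - n) c.src r), c.dir⟩‖ ^ 2)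
          * (∑ r : Fin (F.P K).d → Fin ((F.P K).L ^ (K - n)), ∑ t : Fin ((F.P K).L ^ (K - n)),
            ‖Y ⟨(fun z : Site (F.P K) 0 => z.shift c.dir)^[(t : ℕ)] (Site.fibreSite 0 (K - n) c.src r), c.dir⟩‖ ^ 2) := by ring
      _ ≤ ((F.L : ℝ) ^ (K - n)) ^ 2 * (((F.L : ℝ) ^ (K - n)) ^ ((F.P K).d + 1) * δ ^ 2)
          * ((F.L : ℝ) ^ (K - n) * (∑ r : Fin (F.P K).d → Fin ((F.P K).L ^ (K - n)), ‖Y ⟨Site.fibreSite 0 (K - n) c.src r, c.dir⟩‖ ^ 2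
            + ∑ r : Fin (F.P K).d → Fin ((F.P K).L ^ (K - n)), ‖Y ⟨Site.fibreSite 0 (K - n) (runSite c.src c.dir 1) r, c.dir⟩‖ ^ 2)) := by gcongr
      _ = _ := by ring
  have hAsum : ∑ c : PBond (F.P K) (K - n),
      ‖∑ r : Fin (F.P K).d → Fin ((F.P K).L ^ (K - n)), ∑ t ∈ range ((F.P K).L ^ (K - n)),
        conjR (holT (unitsField (toUField U₀)) (Site.fibreSite 0 (K - n) c.src fun _ => ⟨0, pow_pos (F.P K).L_pos (K - n)⟩)
              (treeWord fun ν => ((r ν : ℕ) : ℤ))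
            * holT (unitsField (toUField U₀)) (Site.fibreSite 0 (K - n) c.src r) (List.replicate t (c.dir, true)))
          (Y ⟨(fun z : Site (F.P K) 0 => z.shift c.dir)^[t] (Site.fibreSite 0 (K - n) c.src r), c.dir⟩)‖ ^ 2
        ≤ ((F.L : ℝ) ^ (K - n)) ^ ((F.P K).d + 4) * δ ^ 2 * (2 * ∑ b : PBond (F.P K) 0, ‖Y b‖ ^ 2) := by
    refine (Finset.sum_le_sum fun c _ => hA c).trans ?_
    rw [← Finset.mul_sum, sum_pair_normSq_eq (P := F.P K) (k := K - n) hsites Y]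
  have hcoef : (1 / 18) * ((((F.L : ℝ) ^ (K - n)) ^ (F.P K).d * ((F.L : ℝ) ^ (K - n)) ^ 2)⁻¹ * (((F.L : ℝ) ^ (K - n)) ^ 2)⁻¹)
      * (((F.L : ℝ) ^ (K - n)) ^ ((F.P K).d + 4) * δ ^ 2 * (2 * ∑ b : PBond (F.P K) 0, ‖Y b‖ ^ 2)) = (1 / 9) * δ ^ 2 * ∑ b : PBond (F.P K) 0, ‖Y b‖ ^ 2 := by
    field_simp; ring
  have hpen : (1 / 18) * ((((F.L : ℝ) ^ (K - n)) ^ (F.P K).d * ((F.L : ℝ) ^ (K - n)) ^ 2)⁻¹ * (((F.L : ℝ) ^ (K - n)) ^ 2)⁻¹)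
      * ∑ c : PBond (F.P K) (K - n),
      ‖∑ r : Fin (F.P K).d → Fin ((F.P K).L ^ (K - n)), ∑ t ∈ range ((F.P K).L ^ (K - n)),
        conjR (holT (unitsField (toUField U₀)) (Site.fibreSite 0 (K - n) c.src fun _ => ⟨0, pow_pos (F.P K).L_pos (K - n)⟩)
              (treeWord fun ν => ((r ν : ℕ) : ℤ))
            * holT (unitsField (toUField U₀)) (Site.fibreSite 0 (K - n) c.src r) (List.replicate t (c.dir, true)))
          (Y ⟨(fun z : Site (F.P K) 0 => z.shift c.dir)^[t] (Site.fibreSite 0 (K - n) c.src r), c.dir⟩)‖ ^ 2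
        ≤ (1 / 9) * δ ^ 2 * ∑ b : PBond (F.P K) 0, ‖Y b‖ ^ 2 := by
    rw [← hcoef]
    exact mul_le_mul_of_nonneg_left hAsum (by positivity)
  -- (3) conclude
  have hkey : (1 / 600) * (((F.L : ℝ) ^ (K - n)) ^ 2)⁻¹ * ∑ b : PBond (F.P K) 0, ‖Y b‖ ^ 2
      ≤ ((1 / 288) * (((F.L : ℝ) ^ (K - n)) ^ 2)⁻¹
          - 12 * (2 * (ε * (((F.L : ℝ) ^ (K - n)) ^ 2)⁻¹) ^ 2 + 128 * δ ^ 2 + 8 * (ε * (((F.L : ℝ) ^ (K - n)) ^ 2)⁻¹))) * ∑ b : PBond (F.P K) 0, ‖Y b‖ ^ 2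
        - (1 / 9) * δ ^ 2 * ∑ b : PBond (F.P K) 0, ‖Y b‖ ^ 2 := by
    nlinarith only [hc, hS0]
  linarith only [hE, hpen, hkey]

end Summit.QuantumFields.YangMills.Theorems.Prop7CovLineAvgTaylor

end
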